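import Summits.BirchSwinnertonDyer.BirchSwinnertonDyer.Theorems.ByReductionTypeAtTwoRankOneAtTwoOneDoorLawFirstLayerDefs
import Literature.NumberTheory.EllipticCurves.BipartiteToricPeriod
import HarnessLib

/-!
# ES-31 (cell bsd-f1-sign2, seat -es g22): THE JOCHNOWITZ CONGRUENCE AT `p = 2` LIVES ONE BINARY DIGIT DEEPER —
# the toric period of the level-raised curve on the DEFINITE quaternion algebra reads the `2`-divisibility of the Heegner point

Sketch only (planner seat; nothing here is proposed to the tree; the typer ports).  Crux `RankOneAtTwoBigImageOddLocal`
(stmt-BirchSwinnertonDyer-23715), LINE v8.17 `one_door_analytic`, registered conjecture-grade stub R₀ / R₀⁺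
(`RankOneAtTwoOneDoor.HeegnerNonDivisibilityAtSelmerTrivialMinimalDoorAtTwo` = W. Zhang's «Kolyvagin conjecture» at `p = 2`).
Zhang's proof for `p ≥ 5` (Camb. J. Math. 2 (2014) §6.4 Thm. 6.5; Bertolini–Darmon, Amer. J. Math. 121 (1999) Thm. 6.1) ends in the
JOCHNOWITZ CONGRUENCE: at an admissible prime `q` inert in `K`, `loc_q κ(y_K) ≠ 0 ⟺ L_alg(g/K, 1)` is a `p`-adic unit, where `g` is the
level-raised newform of level `Nq` and, by Gross's special value formula on the definite quaternion algebra `B = B_{q,∞}` (Eichler order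
`R` of level `N`, class set `S`), `L_alg(g/K,1) ≐ T_g(K)²` with the TORIC PERIOD `T_g(K) = Σ_{σ ∈ Pic 𝒪_K} g_B(σ·x)` of the
Jacquet–Langlands transfer `g_B : S → ℤ` over the conductor-`1` Gross points `x` (= the reduction at `q` of the Heegner divisor,
Deuring–Eichler–Ribet).  Both printed proofs exclude `p = 2` twice: the residue characteristic must be prime to `2Nq(q−1)` (Mazur
multiplicity one) and `p ∤ deg π_E` (the modular degree is EVEN in positive rank — Watkins).  ENGINE J31 (this seat, Sage on kit:
Brandt module of `(q, N)`, unit groups, Gross's ternary lattices `{b ∈ ℤ + 2R_i : tr b = 0, nrd b = |D|}` with orientations TRANSPORTED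
along the connecting ideals, primitive eigenvectors `g_B` of the rational level-raised curves `W'` of ENGINE LR28, Gross–Zagier
Heegner indices) finds, on the slice of 23715 (`r_an = 1`, big image at `2`, odd torsion, odd Tamagawa) at TRANSPOSITION primes `q`:
 (E) `T_{W'}(K)` is ALWAYS EVEN — the definite-side shadow of C. Li's obstruction `dim Sel₂(W'/K) ≥ 2` (the naive `p = 2` Jochnowitz
     congruence is `0 ≡ 0`);
 (J) ONE DIGIT DEEPER IT IS THE JOCHNOWITZ CONGRUENCE: for `T_{W'}(K) ≠ 0`, `T_{W'}(K) ≡ 2 (mod 4)` iff `loc_q y_K ≠ 0` in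
     `E(K_q)/2E(K_q)`, i.e. iff the Heegner point `y_K ∈ E(K)` is NOT `2`-divisible modulo torsion (`m_K := v₂ [E(K) : ℤ y_K + tors] = 0`)
     AND the generator of `E(ℚ)` is not halvable in `E(ℚ_q)` (`= Ẽ(𝔽_q)/2 ≅ ℤ/2` at a transposition prime); `4 ∣ T_{W'}(K)` otherwise;
 (N) and the unit digit FORCES NON-VANISHING: `loc_q y_K ≠ 0 (mod 2)` and `r_an(W') = 0` ⟹ `T_{W'}(K) ≠ 0` (so `L(W'^{(d_K)}, 1) ≠ 0`).
CENSUS (ENGINE J31: kit j332133 odd `N` + j332269 `2 ∥ N` (orientation at `2` fixed), on-frame, `N < 600`, `q ≤ 43`, `h(B) ≤ 400`,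
doors `|d_K| ≤ 200`; 87 + 46 = 133 groups `(W,q)`, 160 + 152 = 312 pairs `(W,q,W')`, 1 406 toric periods): (E) 1 406/1 406 even;
`r_an(W') ≥ 1 ⟹ T = 0` 999/999; (J) 183 + 184 = 367/367 (`T ≠ 0`, rank-`0` `W'`; 293 doors with `T/2` odd, all of class «`m_K = 0 ∧ λ_q ≠ 0`»,
74 with `4 ∣ T ≠ 0`, none of that class); (N) 293/293; the functional form on the `2`-dimensional eigenspace `V = 𝔽₂[S][𝔪_f]` (`d₂ = 2`,
79 + 46 = 125 groups): `Λ_K ≠ 0 ⟺ (m_K = 0 ∧ λ_q ≠ 0)` 690/690 doors, `rank ⟨Λ_K⟩_K ≤ 1` 125/125, `ḡ_B ∈ ker Λ` 252/252; (G) all rational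
`W'` of one group reduce to ONE line of `V`: 67/67 groups with `≥ 2` rational `W'` (up to 13; 573 unordered pairs).  CONTROL C31 (kit j332503):
`T_D = 0 ⟺ L(W'^{(D)},1) = 0` 425/425 and Gross's ratio `L(W'^{(D)},1)√|D| / T_D²` constant in `D` for 100/100 `W'` — the engine's `T` IS the
toric period.
OFF-frame (`ρ̄|_{G_{ℚ₂}} = 1`: `503a1`, `q = 5`, `W' = 2515a1`): (J) fails 2×, (N) fails 2× — the frame is load-bearing, as for ES-28E.
Equivalently (rank-2 form, tested without reference to `W'`): the functional `Λ_K := ⟨·, red_q(Heegner divisor)⟩ (mod 2)` on the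
TWO-dimensional eigenspace `V = 𝔽₂[S][𝔪_f]` vanishes on the line of newform reductions `ḡ_B` and is non-zero on `V` exactly when
`m_K = 0` and `loc_{q} κ(P) ≠ 0 ∈ E(K_q)/2 = Ẽ(𝔽_{q²})/2` — a «Θ : E(K_q)/2 → V^∨» replacing Bertolini–Darmon's `η : E(K_q)/𝔪 ≅ M/𝔪M`.
USE for the crux: (J) + (N) at ONE level-raising prime is exactly the missing last step «ERL at 2» of Zhang's ladder (SUPPLY = Le Hung–Li
level raising mod 2; LOWER∥E = ES-28A; RZ2 = rank-0 `2`-converse for `W'`); it turns R₀ (Heegner non-divisibility at a `Sel₂`-trivial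
minimal door) into a statement about the `2`-adic digit of a FINITE quaternionic sum attached to a RANK-ZERO curve.
The quaternionic binders below are, clause for clause, those of the tree fact `kim_selmerCorank_baseChange_le_of_toricPeriod_ne_zero`
(`Literature/…/BipartiteToricPeriod.lean`, Mathlib-only typing of `B`, Eichler order, invertible right ideals, `T_ℓ`, Gross points, toric
period) with `N⁻ = 1`, `n = q`, values in `ℤ` and eigenvalues `a_ℓ(W')`.
-/

noncomputable section

open scoped Classical BigOperators

set_option linter.dupNamespace false
set_option autoImplicit false

namespace Summit.BirchSwinnertonDyer.BirchSwinnertonDyer.Theorems.RankOneAtTwoJochnowitz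

open Literature.NumberTheory.EllipticCurves Literature.NumberTheory.EllipticCurves.ModularForms
  Summit.BirchSwinnertonDyer.Rank1Residual.F1Sign2
  Summit.BirchSwinnertonDyer.BirchSwinnertonDyer.Theorems.RankOneAtTwoOneDoor
  WeierstrassCurve

/-- The `2`-division cubic `4x³ + b₂x² + 2b₄x + b₆` of `W` (as in the -es g19/g21 workfiles). -/
abbrev twoDivCubic (W : WeierstrassCurve ℚ) : Polynomial ℚ := W.twoTorsionPolynomial.toPoly

/-- `ρ̄_{W,2}|_{G_{ℚ₂}}` is non-trivial: the `2`-division cubic does not split completely over `ℚ₂` (Le Hung–Li 2016, Assumption (4);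
the ES-28E frame hypothesis — off it, ENGINE J31 finds the one counterexample family `503a1, q = 5`). -/
def NontrivialAtTwo (W : WeierstrassCurve ℚ) : Prop :=
  ((twoDivCubic W).map (algebraMap ℚ ℚ_[2])).roots.card < 3

/-- `P ∈ 2·E(ℚ_q)`: the rational point `P` is halvable `q`-adically (for a good TRANSPOSITION prime `q`: `E(ℚ_q)/2 ≅ Ẽ(𝔽_q)/2 ≅ ℤ/2`,
and `E(ℚ_q)/2 ↪ E(K_q)/2` for `q` inert in `K`, `H¹(ℤ/2, W[2]) = 0`). ENGINE J31's `λ_P = 0`. -/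
def LocallyHalvable (W : WeierstrassCurve ℚ) (q : ℕ) [Fact q.Prime] (P : (W.baseChange ℚ).toAffine.Point) : Prop :=
  ∃ Q : (W.baseChange ℚ_[q]).toAffine.Point, 2 • Q = Affine.Point.baseChange (W' := W) ℚ ℚ_[q] P

/-- `P ∉ 2·E(ℚ)` (with `E(ℚ) ≅ ℤ ⊕ (odd)`: `P` is an odd multiple of a generator plus torsion). -/
def NotTwiceRat (W : WeierstrassCurve ℚ) (P : (W.baseChange ℚ).toAffine.Point) : Prop :=
  ¬ ∃ Q : (W.baseChange ℚ).toAffine.Point, 2 • Q = P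

/-- **THE DEFINITE LEVEL-RAISING FRAME** `(W, W', q; B = (a,b)_ℚ, O, RI, φ)`: `W'` of conductor `q·N_W` (`q ∤ N_W`) congruent to `W`
modulo `2` (traces of Frobenius at all primes `ℓ ∤ 2qN_W`); `B = (a, 0, b)_ℚ` definite and a division algebra exactly at `q` among the
finite primes; `O = O₁ ⊓ O₂` an Eichler order of level `N_W` (two maximal `ℤ`-orders, `[O₁ : O] = N_W`); `RI` the invertible right
`O`-ideals; `φ : RI → ℤ` left-`B×`-invariant with `T_ℓ φ = a_ℓ(W') φ` for every prime `ℓ ∤ qN_W` (the Jacquet–Langlands transfer `g_B`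
of the newform of `W'`, any integral multiple) and PRIMITIVE AT `2` (an odd value).  Clauses copied from
`kim_selmerCorank_baseChange_le_of_toricPeriod_ne_zero` with `N⁻ = 1`, `n = q`, `ℤ`-values. [cite: Kim2024, §5.2.2–5.2.3 (shape of the binders)]
[cite: GrossLMS1987, §3 and Prop. 10.3 (heights and the special value formula; shape only)] -/
def DefiniteFrame (W W' : WeierstrassCurve ℚ) [W.IsElliptic] [W.IsGloballyMinimal] [W'.IsElliptic] [W'.IsGloballyMinimal]
    (q : ℕ) (a b : ℚ)
    (O : Subring (QuaternionAlgebra ℚ a 0 b)) (RI : Set (Submodule ℤ (QuaternionAlgebra ℚ a 0 b)))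
    (φ : Submodule ℤ (QuaternionAlgebra ℚ a 0 b) → ℤ) : Prop :=
  -- frame of ES-28 (Le Hung–Li): `4 ∤ N_W`, `ρ̄|_{G_{ℚ₂}} ≠ 1`, `q ∤ 2N_W` a TRANSPOSITION prime
  (¬ 4 ∣ W.conductorNorm ℤ) ∧ NontrivialAtTwo W ∧ q ≠ 2 ∧ (¬ q ∣ W.conductorNorm ℤ) ∧ jacobiSym W.Δ.num q = -1 ∧
  -- level
  (W'.conductorNorm ℤ = q * W.conductorNorm ℤ) ∧
  -- congr
  (∀ ℓ : ℕ, ℓ.Prime → ¬ ℓ ∣ 2 * q * W.conductorNorm ℤ → (2 : ℤ) ∣ W.frobeniusTrace ℓ - W'.frobeniusTrace ℓ) ∧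
  -- definite
  (a < 0 ∧ b < 0) ∧
  -- ramified
  (∀ (ℓ : ℕ) [Fact ℓ.Prime],
    (∀ x : QuaternionAlgebra ℚ_[ℓ] (a : ℚ_[ℓ]) 0 (b : ℚ_[ℓ]), x ≠ 0 → IsUnit x) ↔ ℓ = q) ∧
  -- eichler
  (∃ O₁ O₂ : Subring (QuaternionAlgebra ℚ a 0 b),
    (∀ S : Subring (QuaternionAlgebra ℚ a 0 b), (S = O₁ ∨ S = O₂) →
      (S.toAddSubgroup.FG ∧ (∀ d : QuaternionAlgebra ℚ a 0 b, ∃ m : ℤ, m ≠ 0 ∧ m • d ∈ S) ∧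
        ∀ S' : Subring (QuaternionAlgebra ℚ a 0 b), S'.toAddSubgroup.FG → S ≤ S' → S' = S)) ∧
    O = O₁ ⊓ O₂ ∧ O.toAddSubgroup.relIndex O₁.toAddSubgroup = W.conductorNorm ℤ) ∧
  -- ideals
  (∀ J : Submodule ℤ (QuaternionAlgebra ℚ a 0 b), J ∈ RI ↔
    (J.FG ∧ (∀ d : QuaternionAlgebra ℚ a 0 b, ∃ m : ℤ, m ≠ 0 ∧ m • d ∈ J) ∧
      (∀ x : QuaternionAlgebra ℚ a 0 b, (∀ y ∈ J, y * x ∈ J) ↔ x ∈ O) ∧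
      (∃ J' : Submodule ℤ (QuaternionAlgebra ℚ a 0 b),
        (∀ x : QuaternionAlgebra ℚ a 0 b, x ∈ J * J' ↔ ∀ y ∈ J, x * y ∈ J) ∧
        (∀ x : QuaternionAlgebra ℚ a 0 b, x ∈ J' * J ↔ x ∈ O)))) ∧
  -- invariant
  (∀ J ∈ RI, ∀ β : QuaternionAlgebra ℚ a 0 b, IsUnit β →
    φ (J.map (AddMonoidHom.mulLeft β).toIntLinearMap) = φ J) ∧
  -- eigen
  (∀ ℓ : ℕ, ℓ.Prime → ¬ ℓ ∣ q * W.conductorNorm ℤ → ∀ J ∈ RI,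
    ∑ᶠ J' ∈ {J' : Submodule ℤ (QuaternionAlgebra ℚ a 0 b) | J' ≤ J ∧
        J'.toAddSubgroup.relIndex J.toAddSubgroup = ℓ ^ 2 ∧ ∀ y ∈ J', ∀ x ∈ O, y * x ∈ J'}, φ J' =
      W'.frobeniusTrace ℓ * φ J) ∧
  -- primitive
  (∃ J ∈ RI, Odd (φ J))

/-- **A conductor-`1` Gross point with class representatives** `(ψ, I, rep)`: `I ∈ RI`, `ψ : K → B` embedding `𝒪_K` OPTIMALLY into the
left order of `I`, `rep` integral representatives of `Pic 𝒪_K` (verbatim the last clause block of the Kim fact). [cite: Kim2024, §8 = App. A (shape)] -/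
def GrossPoint {a b : ℚ} (RI : Set (Submodule ℤ (QuaternionAlgebra ℚ a 0 b))) (K : Type) [Field K] [NumberField K]
    (ψ : K →ₐ[ℚ] QuaternionAlgebra ℚ a 0 b) (I : Submodule ℤ (QuaternionAlgebra ℚ a 0 b))
    (rep : ClassGroup (NumberField.RingOfIntegers K) → nonZeroDivisors (Ideal (NumberField.RingOfIntegers K))) : Prop :=
  -- mem
  (I ∈ RI) ∧
  -- embeds
  (∀ x : NumberField.RingOfIntegers K, ∀ y ∈ I, ψ (x : K) * y ∈ I) ∧
  -- optimal
  (∀ x : K, (∀ y ∈ I, ψ x * y ∈ I) → ∃ z : NumberField.RingOfIntegers K, (z : K) = x) ∧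
  -- reps
  (∀ 𝔞 : ClassGroup (NumberField.RingOfIntegers K), ClassGroup.mk0 (rep 𝔞) = 𝔞)

/-- **The toric period** `T_φ(K) = Σ_{[𝔞] ∈ Pic 𝒪_K} φ(ψ(𝔞)·I) ∈ ℤ` (Gross: `L(g/K,1) ≐ T²`; ENGINE J31's `L_{W'}(x_D)`). -/
def toricPeriod {a b : ℚ} (φ : Submodule ℤ (QuaternionAlgebra ℚ a 0 b) → ℤ) (K : Type) [Field K] [NumberField K]
    (ψ : K →ₐ[ℚ] QuaternionAlgebra ℚ a 0 b) (I : Submodule ℤ (QuaternionAlgebra ℚ a 0 b))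
    (rep : ClassGroup (NumberField.RingOfIntegers K) → nonZeroDivisors (Ideal (NumberField.RingOfIntegers K))) : ℤ :=
  ∑ 𝔞 : ClassGroup (NumberField.RingOfIntegers K),
    φ (Submodule.span ℤ ((fun x : NumberField.RingOfIntegers K => ψ (x : K)) ''
        ((rep 𝔞 : nonZeroDivisors (Ideal (NumberField.RingOfIntegers K))) : Ideal (NumberField.RingOfIntegers K))) * I)

/-- **ES-31E `ToricPeriodEvenAtTwo` — THE DEFINITE SHADOW OF LI'S OBSTRUCTION (THEOREM-candidate).**  On the slice of 23715, at a
TRANSPOSITION prime `q` (`(Δ_W/q) = −1`) inert in the Heegner field `K` (odd `d_K < −4`, `(d_K, qN_W) = 1`), the toric period of every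
rational level-raised curve `W'` is EVEN.  Expected mechanism: C. Li's parity obstruction `dim_{𝔽₂} Sel₂(W'/K) ≡ 0 (2)`, `≥ 2` on the definite
side (Gross–Parson: `T` odd ⟹ `Sel₂(W'/K) = 0`); on `V = 𝔽₂[S][𝔪_f]` it says the newform line `ḡ_B` lies in `ker Λ_K`.  Why it might fail: a
rational level raising with `𝔽₂[S][𝔪_f]` one-dimensional (mod-`2` multiplicity one) would give odd periods — ENGINE J31 finds `d₂ ≥ 2` in
166/166 groups.  Census ENGINE J31 j332133 + j332269: 1 406/1 406 on-frame (1 880/1 880 over all odd-`N` groups incl. off-frame). [cite: LeHungLi2016, §1 (mod-2 multiplicity)]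
[cite: GrossParson2012, Prop. 4.1 (shape)] [cite: BertoliniDarmon1999AJM, Thm. 6.1 (p odd)] -/
@[conjecture] def ToricPeriodEvenAtTwo : Prop :=
  ∀ (W : WeierstrassCurve ℚ) [W.IsElliptic] [W.IsGloballyMinimal] [NeZero (W.conductorNorm ℤ)]
    (W' : WeierstrassCurve ℚ) [W'.IsElliptic] [W'.IsGloballyMinimal] (q : ℕ) [Fact q.Prime],
    ¬ W.HasCM → (∀ n : ℕ, W.HasSurjectiveModNGaloisRep ((2 ^ n : ℕ) : ℤ)) → Odd W.torsionOrder → Odd W.tamagawaProduct →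
    W.analyticRank = 1 →
    ∀ (K : Type) [Field K] [NumberField K], IsImaginaryQuadratic K → Odd (NumberField.discr K) → NumberField.discr K < -4 →
      Nat.Coprime (NumberField.discr K).natAbs (q * W.conductorNorm ℤ) → SatisfiesHeegnerHypothesis (W.conductorNorm ℤ) K →
      ((Ideal.span {(q : ℤ)}).primesOver (NumberField.RingOfIntegers K)).ncard = 1 →
    ∀ (a b : ℚ) (O : Subring (QuaternionAlgebra ℚ a 0 b)) (RI : Set (Submodule ℤ (QuaternionAlgebra ℚ a 0 b)))
      (φ : Submodule ℤ (QuaternionAlgebra ℚ a 0 b) → ℤ), DefiniteFrame W W' q a b O RI φ →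
    ∀ (ψ : K →ₐ[ℚ] QuaternionAlgebra ℚ a 0 b) (I : Submodule ℤ (QuaternionAlgebra ℚ a 0 b))
      (rep : ClassGroup (NumberField.RingOfIntegers K) → nonZeroDivisors (Ideal (NumberField.RingOfIntegers K))),
      GrossPoint RI K ψ I rep → (2 : ℤ) ∣ toricPeriod φ K ψ I rep

/-- **ES-31J `JochnowitzSecondDigitAtTwo` — THE JOCHNOWITZ CONGRUENCE AT `2`, ONE DIGIT DEEPER (CONJECTURE of this lens; the `p = 2` first
explicit reciprocity law of the level-raising Euler system, DEFINITE normalisation).**  Same frame; `Dt` a parametrisation datum of level `N_W`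
with ODD constant, `H` a Heegner datum of discriminant `d_K`, `P ∈ E(K)` over the complex Heegner point.  `P₀ ∈ E(ℚ)` not in `2E(ℚ)` (an odd multiple of
the generator up to odd torsion).  THEN, whenever the toric period `T = T_{W'}(K)` is non-zero:  `4 ∤ T` iff (`P ∉ 2E(K) + E(K)_tors` AND
`P₀ ∉ 2E(ℚ_q)`) — i.e. iff `loc_q y_K ≠ 0` in `E(K_q) ⊗ ℤ/2` (the `p = 2` Jochnowitz congruence with `T/2` in place of `T`).  With ES-31E:
`T ≡ 2 (mod 4) ⟺ loc_q y_K ≢ 0`, `4 ∣ T` otherwise.  Why it might fail: (i) `d₂ = dim 𝔽₂[S][𝔪_f] > 2` (several level-raised forms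
congruent mod `2`: ENGINE J31 sees extra functional layers on `V` at `83a1, q = 5`, `163a1, q = 7, 19`, `431a1, q = 7`, though the RATIONAL `W'`
there still obey the law 6/6); (ii) non-optimal data / `v₂(c_{Manin}) > 0` shift `m` (hence ODD constant); (iii) off the frame it IS false
(`503a1`, `q = 5`).  Census ENGINE J31 (j332133 odd `N`, j332269 `2 ∥ N`) × LR28: 367/367 on-frame, see the module docstring (MEMO-es §31). [cite: BertoliniDarmon1999AJM, Thm. 6.1 and §3 assumption 2 (p ∤ 2N·deg π_E)]
[cite: Zhang2014CJM, Thm. 6.5 (p ≥ 5)] [cite: GrossLMS1987, Prop. 10.3 (special value formula; shape)] [cite: GrossZagier1986, Thm. I.6.3 and V.§2] -/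
@[conjecture] def JochnowitzSecondDigitAtTwo : Prop :=
  ∀ (W : WeierstrassCurve ℚ) [W.IsElliptic] [W.IsGloballyMinimal] [NeZero (W.conductorNorm ℤ)]
    (W' : WeierstrassCurve ℚ) [W'.IsElliptic] [W'.IsGloballyMinimal] (q : ℕ) [Fact q.Prime],
    ¬ W.HasCM → (∀ n : ℕ, W.HasSurjectiveModNGaloisRep ((2 ^ n : ℕ) : ℤ)) → Odd W.torsionOrder → Odd W.tamagawaProduct →
    W.analyticRank = 1 →
    ∀ (K : Type) [Field K] [NumberField K], IsImaginaryQuadratic K → Odd (NumberField.discr K) → NumberField.discr K < -4 →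
      Nat.Coprime (NumberField.discr K).natAbs (q * W.conductorNorm ℤ) → SatisfiesHeegnerHypothesis (W.conductorNorm ℤ) K →
      ((Ideal.span {(q : ℤ)}).primesOver (NumberField.RingOfIntegers K)).ncard = 1 →
    ∀ (Dt : ModularParametrizationData W (W.conductorNorm ℤ)) (H : HeegnerDatum (W.conductorNorm ℤ) (NumberField.discr K))
      (ι : K →+* ℂ) (P : (W.baseChange K).toAffine.Point),
      WeierstrassCurve.Affine.Point.map ι.toRatAlgHom P = heegnerPointComplex Dt H → Odd Dt.c →
    ∀ (P₀ : (W.baseChange ℚ).toAffine.Point), NotTwiceRat W P₀ →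
    ∀ (a b : ℚ) (O : Subring (QuaternionAlgebra ℚ a 0 b)) (RI : Set (Submodule ℤ (QuaternionAlgebra ℚ a 0 b)))
      (φ : Submodule ℤ (QuaternionAlgebra ℚ a 0 b) → ℤ), DefiniteFrame W W' q a b O RI φ →
    ∀ (ψ : K →ₐ[ℚ] QuaternionAlgebra ℚ a 0 b) (I : Submodule ℤ (QuaternionAlgebra ℚ a 0 b))
      (rep : ClassGroup (NumberField.RingOfIntegers K) → nonZeroDivisors (Ideal (NumberField.RingOfIntegers K))),
      GrossPoint RI K ψ I rep → toricPeriod φ K ψ I rep ≠ 0 →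
        (¬ (4 : ℤ) ∣ toricPeriod φ K ψ I rep ↔ (HasTwoDivisibilityUpToTorsion W K P 0 ∧ ¬ LocallyHalvable W q P₀))

/-- **ES-31N `ToricPeriodNonvanishingAtTwo` — THE UNIT DIGIT FORCES NON-VANISHING (CONJECTURE; the `p = 2` shadow of «`loc_q κ(y_K) ≠ 0` ⟹
`L(g/K,1) ≠ 0`»).**  Same frame with `r_an(W') = 0`: if the Heegner point has exponent `0` and the generator is not halvable in `E(ℚ_q)` (`loc_q y_K ≢ 0
mod 2`) then the toric period is non-zero (hence, by Gross's formula, `L(W'/K, 1) = L(W',1)·L(W'^{(d_K)},1) ≠ 0`).  Why it might fail: a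
rank-`0` `W'` with `r_an(W'^{(d_K)}) ≥ 2` at such a door — ENGINE J31 j332133 + j332269: 293/293 such (pair, door) have `T ≠ 0`; the 40 rank-`0` doors with
`T = 0` are all of class `λ_q = 0` (4), `m_K ≥ 1` (23) or `y_K` torsion (13); off-frame `503a1, q = 5` fails twice. [cite: Zhang2014CJM, Thm. 6.5 (p ≥ 5; shape)]
[cite: GrossLMS1987, Prop. 10.3] -/
@[conjecture] def ToricPeriodNonvanishingAtTwo : Prop :=
  ∀ (W : WeierstrassCurve ℚ) [W.IsElliptic] [W.IsGloballyMinimal] [NeZero (W.conductorNorm ℤ)]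
    (W' : WeierstrassCurve ℚ) [W'.IsElliptic] [W'.IsGloballyMinimal] (q : ℕ) [Fact q.Prime],
    ¬ W.HasCM → (∀ n : ℕ, W.HasSurjectiveModNGaloisRep ((2 ^ n : ℕ) : ℤ)) → Odd W.torsionOrder → Odd W.tamagawaProduct →
    W.analyticRank = 1 → W'.analyticRank = 0 →
    ∀ (K : Type) [Field K] [NumberField K], IsImaginaryQuadratic K → Odd (NumberField.discr K) → NumberField.discr K < -4 →
      Nat.Coprime (NumberField.discr K).natAbs (q * W.conductorNorm ℤ) → SatisfiesHeegnerHypothesis (W.conductorNorm ℤ) K →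
      ((Ideal.span {(q : ℤ)}).primesOver (NumberField.RingOfIntegers K)).ncard = 1 →
    ∀ (Dt : ModularParametrizationData W (W.conductorNorm ℤ)) (H : HeegnerDatum (W.conductorNorm ℤ) (NumberField.discr K))
      (ι : K →+* ℂ) (P : (W.baseChange K).toAffine.Point),
      WeierstrassCurve.Affine.Point.map ι.toRatAlgHom P = heegnerPointComplex Dt H → Odd Dt.c →
      HasTwoDivisibilityUpToTorsion W K P 0 →
    ∀ (P₀ : (W.baseChange ℚ).toAffine.Point), NotTwiceRat W P₀ → ¬ LocallyHalvable W q P₀ →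
    ∀ (a b : ℚ) (O : Subring (QuaternionAlgebra ℚ a 0 b)) (RI : Set (Submodule ℤ (QuaternionAlgebra ℚ a 0 b)))
      (φ : Submodule ℤ (QuaternionAlgebra ℚ a 0 b) → ℤ), DefiniteFrame W W' q a b O RI φ →
    ∀ (ψ : K →ₐ[ℚ] QuaternionAlgebra ℚ a 0 b) (I : Submodule ℤ (QuaternionAlgebra ℚ a 0 b))
      (rep : ClassGroup (NumberField.RingOfIntegers K) → nonZeroDivisors (Ideal (NumberField.RingOfIntegers K))),
      GrossPoint RI K ψ I rep → toricPeriod φ K ψ I rep ≠ 0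

/-- **ES-31G `GhostLineAtTwo` — ALL LEVEL-RAISED NEWFORMS REDUCE TO ONE LINE MOD `2` (CONJECTURE; the structural reason for ES-31E).**
On the frame, two primitive `ℤ`-valued Hecke eigenfunctions `φ₁, φ₂` on the SAME class set (same `B`, `O`, `RI`) attached to two rational
level-raised curves `W₁', W₂'` of conductor `qN_W`, both congruent to `W` mod `2`, are CONGRUENT MOD `2` as functions on `RI` — the common
eigenspace `𝔽₂[S][𝔪_f]` may be `2`-dimensional or more, but the newform reductions all lie on one line (the «mod-`2` ghost of `f`»).  Why it
might fail: two newforms reducing to different lines of `V` when `d₂ > 2`; a sign/normalisation issue is excluded by primitivity + an odd value.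
Census ENGINE J31 (j332133 + j332269): 67/67 on-frame groups with `≥ 2` rational `W'` (573 unordered pairs, up to 13 curves in one group),
including groups where every `Λ_K` vanishes. [cite: LeHungLi2016, Thm. 1.5 (level raising mod 2; shape)] [cite: BertoliniDarmon1999AJM, Lemma 6.3 (deg π_E; heuristic)] -/
@[conjecture] def GhostLineAtTwo : Prop :=
  ∀ (W : WeierstrassCurve ℚ) [W.IsElliptic] [W.IsGloballyMinimal] [NeZero (W.conductorNorm ℤ)]
    (W₁' : WeierstrassCurve ℚ) [W₁'.IsElliptic] [W₁'.IsGloballyMinimal]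
    (W₂' : WeierstrassCurve ℚ) [W₂'.IsElliptic] [W₂'.IsGloballyMinimal] (q : ℕ) [Fact q.Prime],
    ¬ W.HasCM → (∀ n : ℕ, W.HasSurjectiveModNGaloisRep ((2 ^ n : ℕ) : ℤ)) → Odd W.torsionOrder → Odd W.tamagawaProduct →
    W.analyticRank = 1 →
    ∀ (a b : ℚ) (O : Subring (QuaternionAlgebra ℚ a 0 b)) (RI : Set (Submodule ℤ (QuaternionAlgebra ℚ a 0 b)))
      (φ₁ φ₂ : Submodule ℤ (QuaternionAlgebra ℚ a 0 b) → ℤ),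
      DefiniteFrame W W₁' q a b O RI φ₁ → DefiniteFrame W W₂' q a b O RI φ₂ →
      ∀ J ∈ RI, (2 : ℤ) ∣ φ₁ J - φ₂ J

/-- Elementary glue (the shape in which the crux's first layer R₀ would consume ES-31): on a door where SOME level-raised rational `W'`
has toric period `≡ 2 (mod 4)`, ES-31J gives exponent `0` for the Heegner point — Heegner NON-divisibility from a rank-`0`, finite,
quaternionic datum.  (The converse supply «such a `W'`, `q` exist at every `Sel₂`-trivial minimal door» = Le Hung–Li level raising mod 2 +
ES-28A + a rank-`0` `2`-converse for `W'` over `K`, is the rest of Zhang's ladder and is NOT asserted here.) -/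
theorem exponent_zero_of_toricPeriod_two_mod_four (hJ : JochnowitzSecondDigitAtTwo)
    (W : WeierstrassCurve ℚ) [W.IsElliptic] [W.IsGloballyMinimal] [NeZero (W.conductorNorm ℤ)]
    (W' : WeierstrassCurve ℚ) [W'.IsElliptic] [W'.IsGloballyMinimal] (q : ℕ) [Fact q.Prime]
    (hCM : ¬ W.HasCM) (hsurj : ∀ n : ℕ, W.HasSurjectiveModNGaloisRep ((2 ^ n : ℕ) : ℤ)) (hT : Odd W.torsionOrder)
    (hc : Odd W.tamagawaProduct) (hr : W.analyticRank = 1)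
    (K : Type) [Field K] [NumberField K] (hK : IsImaginaryQuadratic K) (hodd : Odd (NumberField.discr K))
    (h4 : NumberField.discr K < -4) (hcop : Nat.Coprime (NumberField.discr K).natAbs (q * W.conductorNorm ℤ))
    (hH : SatisfiesHeegnerHypothesis (W.conductorNorm ℤ) K)
    (hin : ((Ideal.span {(q : ℤ)}).primesOver (NumberField.RingOfIntegers K)).ncard = 1)
    (Dt : ModularParametrizationData W (W.conductorNorm ℤ)) (Hd : HeegnerDatum (W.conductorNorm ℤ) (NumberField.discr K))
    (ι : K →+* ℂ) (P : (W.baseChange K).toAffine.Point)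
    (hP : WeierstrassCurve.Affine.Point.map ι.toRatAlgHom P = heegnerPointComplex Dt Hd) (hcodd : Odd Dt.c)
    (P₀ : (W.baseChange ℚ).toAffine.Point) (hP₀ : NotTwiceRat W P₀)
    (a b : ℚ) (O : Subring (QuaternionAlgebra ℚ a 0 b)) (RI : Set (Submodule ℤ (QuaternionAlgebra ℚ a 0 b)))
    (φ : Submodule ℤ (QuaternionAlgebra ℚ a 0 b) → ℤ) (hF : DefiniteFrame W W' q a b O RI φ)
    (ψ : K →ₐ[ℚ] QuaternionAlgebra ℚ a 0 b) (I : Submodule ℤ (QuaternionAlgebra ℚ a 0 b))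
    (rep : ClassGroup (NumberField.RingOfIntegers K) → nonZeroDivisors (Ideal (NumberField.RingOfIntegers K)))
    (hx : GrossPoint RI K ψ I rep) (h2 : toricPeriod φ K ψ I rep % 4 = 2) :
    HasTwoDivisibilityUpToTorsion W K P 0 := by
  have hne : toricPeriod φ K ψ I rep ≠ 0 := by
    intro h0; rw [h0] at h2; norm_num at h2
  have h4n : ¬ (4 : ℤ) ∣ toricPeriod φ K ψ I rep := by
    intro hd; have := Int.emod_emod_of_dvd (toricPeriod φ K ψ I rep) (dvd_refl (4:ℤ)); omega
  exact ((hJ W W' q hCM hsurj hT hc hr K hK hodd h4 hcop hH hin Dt Hd ι P hP hcodd P₀ hP₀ a b O RI φ hF ψ I rep hx hne).mp h4n).1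

end Summit.BirchSwinnertonDyer.BirchSwinnertonDyer.Theorems.RankOneAtTwoJochnowitz
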